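import Summits.AtomisticToContinuum.BoseEinsteinCondensation.Theorems.BECThomsonPrincipleDensityResponseTruncationLimitExotic
import HarnessLib.Audit

/-!
# Line `force-balance-constitutive` — crux `DensityResponse` (stmt-AtomisticToContinuum-9481): registered skeleton (reshape 4)

Lead c1's skeleton (prover-line-stmt-AtomisticToContinuum-9481-c1-0, 2026-08-16, cycle 1, reshape 4 of lead -0's line).  Everything but
the ONE `sorry` below is a theorem OF THE TREE (`Theorems/BECThomsonPrincipleDensityResponse*.lean`, namespace as below):

* S1 `stub_transportStationary` — PROVED (`…TransportStationary.lean` and the nine files behind it, p90873);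
* S3a/S3b `stub_kineticSignCoherence{Bounded,Unbounded}` — PROVED (`…KineticSignCoherence.lean`, p76359);
* S4 / S4'' the truncation limit — PROVED FOR EVERY ADMISSIBLE `v` (`…TruncationLimitExotic.lean`, p122973: `truncationLimitAt_zero`
  from the Literature form-core theorem `maxFormBound_of_isRepulsiveFiniteRange` + `truncationLimit_of_maxFormBound`; the earlier
  integrable / solid-hard-core cases `…TruncationLimit.lean` p97122, `…TruncationLimitHardCore.lean` p120921 are now special cases);
* the composition — `…Composition.lean` / `…CompositionAt.lean` (p97757, p121550) and `densityResponse_of_constitutiveCore :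
  ConstitutiveCore → DensityResponse` (p122973): **the crux follows from S2 ALONE, for every repulsive finite-range potential**;
* calibration — `…CoreCalibration.lean` (p99042: S2 true at `a(v) = 0`; crux ⟹ S2's `CoreIneq` for bounded `v`) and
  `…InfraredEquiv.lean` (`densityResponse_iff_infraredHalf`: the crux BY NAME ⟺ the infrared half of the sibling crux
  `StaticResponseBound`, stmt-12057 — so S2's open content is exactly that infrared half).

OPEN (the one `sorry`): S2 `stub_constitutiveCore : ConstitutiveCore` — the thermodynamic-limit linear-response (compressibility) content
of the crux in constitutive dress; research-open (see `Lines/force-balance-constitutive.dead.md` / `CORE-c1.md`).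
-/

namespace Summit.AtomisticToContinuum.BoseEinsteinCondensation.Cruxes.DensityResponse.ForceBalanceConstitutive

open Summit.AtomisticToContinuum.BoseEinsteinCondensation.Theses

noncomputable section

/-! ### Audit name of the open stub statement -/

namespace Goal

/-- Statement of stub S2 `stub_constitutiveCore`. -/
abbrev stub_constitutiveCore : Prop := ConstitutiveCore

end Goal

/-! ### Registered stub (open) -/

/-- S2 (XL, hardest, the open core): the constitutive inequality at drives `s ≤ ρa`. -/
theorem stub_constitutiveCore : ConstitutiveCore := by
  sorry

/-! ### The composition (tree theorem `densityResponse_of_constitutiveCore`) -/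

/-- **The composition**: the single open stub implies the crux BY NAME. -/
theorem DensityResponse_of_open : Goal.stub_constitutiveCore → BECThomsonPrinciple.DensityResponse :=
  fun h₂ => densityResponse_of_constitutiveCore h₂

/-- The skeleton as a (sorried-through-the-stub) proof of the crux. -/
theorem DensityResponse_proof : BECThomsonPrinciple.DensityResponse :=
  DensityResponse_of_open stub_constitutiveCore

end

end Summit.AtomisticToContinuum.BoseEinsteinCondensation.Cruxes.DensityResponse.ForceBalanceConstitutive
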